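import Mathlib
import HarnessLib
import Summits.HodgeConjecture.HodgeConjecture.Theorems.FermatCyclesModpTransfer

/-!
# Fermat cycles — rank / linear-independence form of the mod-`p` → `ℚ` transfer

HONEST FRAMING: explicit algebraic cycles for specific Hodge classes on Fermat/Delsarte varieties;
residual open instances listed; no claim on general Hodge.

`FermatCyclesModpTransfer` formalises the *full-rank* transfer (`rows span 𝔽_pⁿ ⇒ rows span ℚⁿ`)
behind the emptiness certificates of `ALBANESE.md` §5.11(c), §5.11″.  The degree certificate of
§5.11‴ (gen-13, residue (C2*)) needs the *inequality* form: for an integer matrix `A` (a Macaulay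
matrix of the homogenised members in one degree), **rank over `ℚ` ≥ rank modulo `p`**, used as
`dim_ℚ J_d ≥ dim_{𝔽_p} (J_p)_d`, i.e. `H(S/J_ℚ, d) ≤ H(S_p/J_p, d)` for every `d`.

* `linearIndependent_rows_rat_of_zmod` — rows whose reductions are linearly independent over
  `ZMod p` are linearly independent over `ℚ`;
* `finrank_span_rows_zmod_le_rat` — `finrank_{𝔽_p} (span rows mod p) ≤ finrank_ℚ (span rows)`.

Everything is proved (no named fact, no `sorry`).
-/

namespace Summit.HodgeConjecture.HodgeConjecture.FermatCycles.RankTransfer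

open Matrix Finset Module
open Summit.HodgeConjecture.HodgeConjecture.FermatCycles.ModpTransfer

variable {m n : Type*}

/-- A linear combination of the rows of `B` is `Bᵀ *ᵥ` (coefficient vector). -/
theorem sum_smul_rows_eq_transpose_mulVec [Fintype m] {R : Type*} [CommRing R] (B : Matrix m n R)
    (c : m → R) : (∑ i, c i • B i) = Bᵀ *ᵥ c := by
  funext j
  simp only [Finset.sum_apply, Pi.smul_apply, smul_eq_mul, Matrix.mulVec, dotProduct,
    Matrix.transpose_apply]
  exact Finset.sum_congr rfl (fun i _ => mul_comm _ _)

/-- **Linear-independence form of the transfer.**  If the reductions modulo a prime `p` of the rows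
of an integer matrix are linearly independent over `ZMod p`, the rows are linearly independent
over `ℚ`. -/
theorem linearIndependent_rows_rat_of_zmod [Fintype m] [Fintype n] (A : Matrix m n ℤ) (p : ℕ) [hp : Fact p.Prime]
    (h : LinearIndependent (ZMod p) (fun i => (A.map (Int.castRingHom (ZMod p))) i)) :
    LinearIndependent ℚ (fun i => (A.map (Int.cast : ℤ → ℚ)) i) := by
  classical
  rw [Fintype.linearIndependent_iff] at h ⊢
  intro c hc
  -- injectivity of `A̅ᵀ *ᵥ ·` over `ZMod p` from independence of the reduced rows
  have hinjp : ∀ y : m → ZMod p, (Aᵀ.map (Int.castRingHom (ZMod p))) *ᵥ y = 0 → y = 0 := by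
    intro y hy
    have hsum : (∑ i, y i • (A.map (Int.castRingHom (ZMod p))) i) = 0 := by
      rw [sum_smul_rows_eq_transpose_mulVec, ← Matrix.transpose_map]; exact hy
    funext i; exact h y hsum i
  have hAc : (Aᵀ.map (Int.cast : ℤ → ℚ)) *ᵥ c = 0 := by
    rw [Matrix.transpose_map, ← sum_smul_rows_eq_transpose_mulVec]; exact hc
  have hc0 := mulVec_eq_zero_only_zero_rat_of_zmod Aᵀ p hinjp c hAc
  intro i; exact congrFun hc0 i

/-- **Rank form of the transfer**: `finrank` of the row span can only drop under reduction
modulo `p`; equivalently rank over `ℚ` ≥ rank over `𝔽_p`. -/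
theorem finrank_span_rows_zmod_le_rat [Fintype n] (A : Matrix m n ℤ) (p : ℕ) [hp : Fact p.Prime] :
    finrank (ZMod p) (Submodule.span (ZMod p) (Set.range fun i => (A.map (Int.castRingHom (ZMod p))) i))
      ≤ finrank ℚ (Submodule.span ℚ (Set.range fun i => (A.map (Int.cast : ℤ → ℚ)) i)) := by
  classical
  set t : Set (n → ZMod p) := Set.range fun i => (A.map (Int.castRingHom (ZMod p))) i with ht
  obtain ⟨f, hft, -, hf⟩ := Submodule.exists_fun_fin_finrank_span_eq (ZMod p) t
  -- each `f k` is a reduced row: pick its index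
  have hg : ∀ k, ∃ i, (A.map (Int.castRingHom (ZMod p))) i = f k := fun k => hft k
  choose g hg using hg
  -- the rows `g k` of `A`, as an integer matrix
  let B : Matrix (Fin (finrank (ZMod p) (Submodule.span (ZMod p) t))) n ℤ := A.submatrix g id
  have hBp : LinearIndependent (ZMod p) (fun k => (B.map (Int.castRingHom (ZMod p))) k) := by
    have : (fun k => (B.map (Int.castRingHom (ZMod p))) k) = f := by
      funext k; rw [← hg k]; rfl
    rw [this]; exact hf
  have hBq := linearIndependent_rows_rat_of_zmod B p hBp
  have hcard := finrank_span_eq_card hBq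
  rw [Fintype.card_fin] at hcard
  have hle : Submodule.span ℚ (Set.range fun k => (B.map (Int.cast : ℤ → ℚ)) k)
      ≤ Submodule.span ℚ (Set.range fun i => (A.map (Int.cast : ℤ → ℚ)) i) := by
    apply Submodule.span_mono
    rintro _ ⟨k, rfl⟩
    exact ⟨g k, rfl⟩
  calc finrank (ZMod p) (Submodule.span (ZMod p) t)
      = finrank ℚ (Submodule.span ℚ (Set.range fun k => (B.map (Int.cast : ℤ → ℚ)) k)) := hcard.symm
    _ ≤ finrank ℚ (Submodule.span ℚ (Set.range fun i => (A.map (Int.cast : ℤ → ℚ)) i)) :=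
        Submodule.finrank_mono hle

end Summit.HodgeConjecture.HodgeConjecture.FermatCycles.RankTransfer
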